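import Mathlib
import Literature.Probability.LatticeModels.TorusFourierProofs

/-!
# Route BalabanIR — crux 3 `BirBdGPhaseCoercivity` (item `stmt-HubbardSuperconductivity-2081`):
# III. The hopping and pairing stencils of the d+id BdG matrix and their symbols

Third file of the frozen-Nambu-metric reduction. The crux's one-body data on `(ℤ/L)²` are the
hopping matrix `h_{xy} = -[x ∼ y] - μ[x = y]` and the bond pairing matrix
`D(θ)_{xy} = d(y - x) (e^{iθ_x} + e^{iθ_y})/2`, `d = Δ₁ g_{x²-y²} + iΔ₂ g_{xy}`. Here:
`h = circulant a`, `D(θ) = ½ (U C + C U)` with `C = circulant d`, `U = diagonal e^{iθ}`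
(`hopping_eq_circulant`, `pairing_eq_anticommutator`), and, for `L ≥ 3`, the symbols
`FTa(k) = ξ_k = -2cos p₁ - 2cos p₂ - μ` and `FTd(k) = Δ_k = 2Δ₁(cos p₁ - cos p₂) - 4iΔ₂ sin p₁ sin p₂`,
`p = 2πk/L` (`torusFourier_hopVec`, `torusFourier_pairVec`), plus the full gap
`ξ_k² + |Δ_k|² > 0` for `μ ∈ (-4,4)`, `Δ₁Δ₂ ≠ 0` (`bdg_dispersion_pos`).

References: the crux docstring (`Theses/BalabanIR.lean`, `BirBdGPhaseCoercivity`); Friedli–Velenik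
2017, §10.4 for the characters. No definition is introduced.
-/

noncomputable section

namespace Summit.HubbardSuperconductivity.HubbardSuperconductivity.Theorems

namespace BirBdG

open Matrix Finset Literature.Probability.LatticeModels
open scoped ComplexConjugate

variable {L : ℕ}

/-! ### Small vectors of `(ℤ/L)²` -/

/-- `(-1, 0) = -(1, 0)` in `(ℤ/L)²`. [folklore] -/
theorem vec_neg10 : (![-1, 0] : TorusSite 2 L) = -![1, 0] := by
  ext i; fin_cases i <;> simp

/-- `(0, -1) = -(0, 1)` in `(ℤ/L)²`. [folklore] -/
theorem vec_neg01 : (![0, -1] : TorusSite 2 L) = -![0, 1] := by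
  ext i; fin_cases i <;> simp

/-- `(-1, -1) = -(1, 1)` in `(ℤ/L)²`. [folklore] -/
theorem vec_neg11 : (![-1, -1] : TorusSite 2 L) = -![1, 1] := by
  ext i; fin_cases i <;> simp

/-- `(-1, 1) = -(1, -1)` in `(ℤ/L)²`. [folklore] -/
theorem vec_neg1m1 : (![-1, 1] : TorusSite 2 L) = -![1, -1] := by
  ext i; fin_cases i <;> simp

/-- `(1, 0) = e₀`. [folklore] -/
theorem vec10_eq_single : (![1, 0] : TorusSite 2 L) = Pi.single 0 1 := by
  ext i; fin_cases i <;> simp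

/-- `(0, 1) = e₁`. [folklore] -/
theorem vec01_eq_single : (![0, 1] : TorusSite 2 L) = Pi.single 1 1 := by
  ext i; fin_cases i <;> simp

/-- `(1, 1) = e₀ + e₁`. [folklore] -/
theorem vec11_eq : (![1, 1] : TorusSite 2 L) = Pi.single 0 1 + Pi.single 1 1 := by
  ext i; fin_cases i <;> simp

/-- `(1, -1) = e₀ - e₁`. [folklore] -/
theorem vec1m1_eq : (![1, -1] : TorusSite 2 L) = Pi.single 0 1 - Pi.single 1 1 := by
  ext i; fin_cases i <;> simp

/-- `y = x + v ↔ x - y = -v` in an additive commutative group. [folklore] -/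
theorem eq_add_iff_sub_eq_neg {G : Type*} [AddCommGroup G] (x y v : G) :
    y = x + v ↔ x - y = -v := by
  constructor
  · rintro rfl; abel
  · intro h
    have : y = x - (x - y) := by abel
    rw [this, h]; abel

/-! ### The hopping matrix is circulant -/

/-- The crux's hopping matrix `h_{xy} = -[y = x ± e₁ ∨ y = x ± e₂] - μ[x = y]` is the circulant of
the stencil `a(r) = -[r = ∓e₁ ∨ r = ∓e₂] - μ[r = 0]` (`circulant a x y = a (x - y)`). [folklore] -/
theorem hopping_eq_circulant (μ : ℝ) :
    (fun x y : TorusSite 2 L =>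
        -(if ((y = x + ![1, 0] ∨ y = x + ![-1, 0]) ∨ (y = x + ![0, 1] ∨ y = x + ![0, -1]))
            then (1 : ℂ) else 0) - (if x = y then (μ : ℂ) else 0) :
        Matrix (TorusSite 2 L) (TorusSite 2 L) ℂ) =
      Matrix.circulant (fun r : TorusSite 2 L =>
        -(if ((r = -![1, 0] ∨ r = -![-1, 0]) ∨ (r = -![0, 1] ∨ r = -![0, -1]))
            then (1 : ℂ) else 0) - (if r = 0 then (μ : ℂ) else 0)) := by
  ext x y
  rw [Matrix.circulant_apply]
  simp only [eq_add_iff_sub_eq_neg x y, sub_eq_zero]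

/-- The crux's pairing matrix `D(θ)_{xy} = d(y-x)(e^{iθ_x} + e^{iθ_y})/2` is
`½ (U C + C U)` with `U = diagonal (e^{iθ})` and `C = circulant` of the reflected stencil. [folklore] -/
theorem pairing_eq_anticommutator [NeZero L] (Δ₁ Δ₂ : ℝ) (θ : TorusSite 2 L → ℝ) :
    (fun x y : TorusSite 2 L =>
        ((Δ₁ : ℂ) * ((if (y = x + ![1, 0] ∨ y = x + ![-1, 0]) then (1 : ℂ) else 0) -
            (if (y = x + ![0, 1] ∨ y = x + ![0, -1]) then (1 : ℂ) else 0)) +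
          Complex.I * (Δ₂ : ℂ) * ((if (y = x + ![1, 1] ∨ y = x + ![-1, -1]) then (1 : ℂ) else 0) -
            (if (y = x + ![1, -1] ∨ y = x + ![-1, 1]) then (1 : ℂ) else 0))) *
        (Complex.exp (Complex.I * (θ x : ℂ)) + Complex.exp (Complex.I * (θ y : ℂ))) / 2 :
        Matrix (TorusSite 2 L) (TorusSite 2 L) ℂ) =
      (1 / 2 : ℂ) • (Matrix.diagonal (fun x => Complex.exp (Complex.I * (θ x : ℂ))) *
          Matrix.circulant (fun r : TorusSite 2 L =>
            (Δ₁ : ℂ) * ((if (r = -![1, 0] ∨ r = -![-1, 0]) then (1 : ℂ) else 0) -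
              (if (r = -![0, 1] ∨ r = -![0, -1]) then (1 : ℂ) else 0)) +
            Complex.I * (Δ₂ : ℂ) * ((if (r = -![1, 1] ∨ r = -![-1, -1]) then (1 : ℂ) else 0) -
              (if (r = -![1, -1] ∨ r = -![-1, 1]) then (1 : ℂ) else 0))) +
        Matrix.circulant (fun r : TorusSite 2 L =>
            (Δ₁ : ℂ) * ((if (r = -![1, 0] ∨ r = -![-1, 0]) then (1 : ℂ) else 0) -
              (if (r = -![0, 1] ∨ r = -![0, -1]) then (1 : ℂ) else 0)) +
            Complex.I * (Δ₂ : ℂ) * ((if (r = -![1, 1] ∨ r = -![-1, -1]) then (1 : ℂ) else 0) -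
              (if (r = -![1, -1] ∨ r = -![-1, 1]) then (1 : ℂ) else 0))) *
          Matrix.diagonal (fun x => Complex.exp (Complex.I * (θ x : ℂ)))) := by
  ext x y
  rw [Matrix.smul_apply, Matrix.add_apply, Matrix.diagonal_mul, Matrix.mul_diagonal]
  simp only [Matrix.circulant_apply, eq_add_iff_sub_eq_neg x y, smul_eq_mul]
  ring

/-! ### Sums against two-point stencils -/

/-- `Σ_r [r = v ∨ r = w] f(r) = f(v) + f(w)` for `v ≠ w`. [folklore] -/
theorem sum_ite_or_mul {n : Type*} [Fintype n] [DecidableEq n] (v w : n) (hvw : v ≠ w)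
    (f : n → ℂ) :
    ∑ r, (if (r = v ∨ r = w) then (1 : ℂ) else 0) * f r = f v + f w := by
  have : ∀ r, (if (r = v ∨ r = w) then (1 : ℂ) else 0) * f r =
      (if r = v then f r else 0) + (if r = w then f r else 0) := by
    intro r
    by_cases hv : r = v
    · subst hv
      simp [hvw]
    · by_cases hw : r = w
      · subst hw
        simp [hv]
      · simp [hv, hw]
  simp_rw [this, Finset.sum_add_distrib, Finset.sum_ite_eq', Finset.mem_univ, if_true]

/-! ### Character values at the stencil vectors -/

/-- `χ_k(eᵢ) = exp(i pᵢ)`, `pᵢ = 2πkᵢ/L`. [cite: FriedliVelenik2017, §10.4] -/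
theorem torusChar_single_eq_exp [NeZero L] {d : ℕ} (k : TorusSite d L) (i : Fin d) :
    torusChar k (Pi.single i 1) = Complex.exp ((latticeMomentum L k i : ℂ) * Complex.I) := by
  unfold torusChar
  rw [← Finset.prod_erase_mul _ _ (Finset.mem_univ i), Pi.single_eq_same, Finset.prod_eq_one,
    one_mul]
  · rw [mul_one, ← ZMod.natCast_zmod_val (k i), ZMod.stdAddChar_apply, ZMod.toCircle_natCast]
    congr 1
    simp only [latticeMomentum]
    push_cast
    ring
  · intro j hj
    rw [Pi.single_eq_of_ne (Finset.ne_of_mem_erase hj), mul_zero, AddChar.map_zero_eq_one]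

/-- `χ_k(e) + conj χ_k(e) = 2 cos p·e`-type identity at a unit vector:
`χ_k(eᵢ) + conj χ_k(eᵢ) = 2cos pᵢ`. [cite: FriedliVelenik2017, §10.4] -/
theorem torusChar_single_add_conj' [NeZero L] {d : ℕ} (k : TorusSite d L) (i : Fin d) :
    torusChar k (Pi.single i 1) + conj (torusChar k (Pi.single i 1)) =
      ((2 * Real.cos (latticeMomentum L k i) : ℝ) : ℂ) := by
  rw [Complex.add_conj, torusChar_single_eq_exp, Complex.exp_ofReal_mul_I_re]

/-- `χ_k(e₀ + e₁) + conj χ_k(e₀ + e₁) = 2cos(p₀ + p₁)` on `(ℤ/L)²`. [cite: FriedliVelenik2017, §10.4] -/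
theorem torusChar_diag_add_conj [NeZero L] (k : TorusSite 2 L) :
    torusChar k (Pi.single 0 1 + Pi.single 1 1) + conj (torusChar k (Pi.single 0 1 + Pi.single 1 1)) =
      ((2 * Real.cos (latticeMomentum L k 0 + latticeMomentum L k 1) : ℝ) : ℂ) := by
  rw [Complex.add_conj, torusChar_add_right, torusChar_single_eq_exp, torusChar_single_eq_exp,
    ← Complex.exp_add]
  have : ((latticeMomentum L k 0 : ℂ) * Complex.I + (latticeMomentum L k 1 : ℂ) * Complex.I) =
      ((latticeMomentum L k 0 + latticeMomentum L k 1 : ℝ) : ℂ) * Complex.I := by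
    push_cast; ring
  rw [this, Complex.exp_ofReal_mul_I_re]

/-- `χ_k(e₀ - e₁) + conj χ_k(e₀ - e₁) = 2cos(p₀ - p₁)` on `(ℤ/L)²`. [cite: FriedliVelenik2017, §10.4] -/
theorem torusChar_antidiag_add_conj [NeZero L] (k : TorusSite 2 L) :
    torusChar k (Pi.single 0 1 - Pi.single 1 1) + conj (torusChar k (Pi.single 0 1 - Pi.single 1 1)) =
      ((2 * Real.cos (latticeMomentum L k 0 - latticeMomentum L k 1) : ℝ) : ℂ) := by
  rw [Complex.add_conj, torusChar_sub_right, torusChar_single_eq_exp, torusChar_single_eq_exp,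
    ← Complex.exp_conj, ← Complex.exp_add]
  have : ((latticeMomentum L k 0 : ℂ) * Complex.I + conj ((latticeMomentum L k 1 : ℂ) * Complex.I)) =
      ((latticeMomentum L k 0 - latticeMomentum L k 1 : ℝ) : ℂ) * Complex.I := by
    rw [map_mul, Complex.conj_ofReal, Complex.conj_I]
    push_cast; ring
  rw [this, Complex.exp_ofReal_mul_I_re]

/-- Sum of a character over a symmetric pair `{-v, v}` (`v ≠ -v`):
`Σ_r [r = -v ∨ r = v] conj χ_k(r) = χ_k(v) + conj χ_k(v)`. [folklore] -/
theorem sum_pair_conj_torusChar [NeZero L] {d : ℕ} (k v : TorusSite d L) (hv : -v ≠ v) :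
    ∑ r, (if (r = -v ∨ r = v) then (1 : ℂ) else 0) * conj (torusChar k r) =
      torusChar k v + conj (torusChar k v) := by
  rw [sum_ite_or_mul (-v) v hv, torusChar_neg_right, Complex.conj_conj]

/-- Indicator of a disjoint disjunction splits: `[A ∨ B] = [A] + [B]` if `¬(A ∧ B)`. [folklore] -/
theorem ite_or_eq_add {A B : Prop} [Decidable A] [Decidable B] (h : ¬(A ∧ B)) :
    (if (A ∨ B) then (1 : ℂ) else 0) = (if A then (1 : ℂ) else 0) + (if B then (1 : ℂ) else 0) := by
  by_cases hA : A
  · have hB : ¬B := fun hB => h ⟨hA, hB⟩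
    simp [hA, hB]
  · by_cases hB : B
    · simp [hA, hB]
    · simp [hA, hB]

/-- Distinctness of the stencil vectors for `L ≥ 3`: `(1 : ZMod L) ≠ -1`. [folklore] -/
theorem one_ne_neg_one_zmod (hL : 3 ≤ L) : (1 : ZMod L) ≠ -1 := by
  intro h
  have h2 : ((2 : ℕ) : ZMod L) = 0 := by
    rw [Nat.cast_ofNat]
    linear_combination h
  rw [ZMod.natCast_eq_zero_iff] at h2
  have := Nat.le_of_dvd (by norm_num) h2
  exact absurd (hL.trans this) (by norm_num)

/-- `(1 : ZMod L) ≠ 0` for `L ≥ 2`. [folklore] -/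
theorem one_ne_zero_zmod [NeZero L] (hL : 2 ≤ L) : (1 : ZMod L) ≠ 0 := by
  haveI : Fact (1 < L) := ⟨lt_of_lt_of_le one_lt_two hL⟩
  exact one_ne_zero

end BirBdG

end Summit.HubbardSuperconductivity.HubbardSuperconductivity.Theorems

end
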